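import Summits.AtomisticToContinuum.Crystallization.Theses.EnergyDerivativeOrder
import Summits.AtomisticToContinuum.Crystallization.Theorems.EnergyDerivativeOrderLimitTransferGoodParticle
import Summits.AtomisticToContinuum.Crystallization.Theorems.EnergyDerivativeOrderLimitTransferLocalLimit
import Literature.MathematicalPhysics.StatisticalMechanics.CrystallizationLocalLimit
import Literature.MathematicalPhysics.StatisticalMechanics.CrystallizationSymmetries

/-!
# Route EnergyDerivativeOrder — `LimitTransfer` (item stmt-AtomisticToContinuum-12284)

`LimitTransfer`: `SpectralRigidityHcp → GappedKissingBound →` for `hcp(a, h)` in the window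
`|h/a − √(2/3)| ≤ 1/400` and ANY sequence of `N`-point configurations `x^N` of `ℝ³` with a
uniform minimal distance `δ > 0` whose smooth pair statistics `𝓔_W(x^N)/N` converge to
`(hcp(a,h)).energyPerParticle W` for every `C²` compactly supported `W`, the Blanc–Lewin
conclusion (2015, §2.1 (16)) holds: along a subsequence and after translations the empirical
measures converge locally to `∑_{s ∈ P.points} m(s) δ_s` for a periodic `P` (an isometric image
of hcp, `m ≡ 1`).

Proof (`limitTransfer_proof`).
* Step A (`eventually_exists_good`, helper VI): at every scale `k` (radius `2a + k`, tolerance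
  `a/4000/(k+1)`), eventually in `N` some particle has a defect-free ball — all pairs in the
  ball at distances within the tolerance of realised hcp distances, every particle of the ball
  with exactly twelve others within `6a/5` (forbidden-distance and first-shell test functions,
  the gapped kissing bound, packing and pigeonhole).
* Step B: `Filter.extraction_forall_of_eventually` picks `N_k ↑` and good particles `i_k`;
  recentre; the tree's sequential compactness in the local matching topology
  (`exists_subseq_forall_eventually_ballMatch`) gives a subsequence and a `δ`-separated local
  limit `Y`.
* Step C (helper III): `0 ∈ Y`; all pair distances of `Y` are realised hcp distances
  (`dist_mem_of_ballMatch`, using the local finiteness of the hcp distance set); every point of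
  `Y` has exactly twelve others within `6a/5` (`ncard_shell_of_ballMatch`, using the spectral
  gap `(1.1a, 1.3a)`). Hence `Y = g '' hcpStacking a h` by `SpectralRigidityHcp`.
* Step D: `g = B(·) + g 0` with `B` linear (Mazur–Ulam), so `Y` is the point set of the
  periodic configuration `((hcp).isometryImage B).translate (g 0)` (`CrystallizationSymmetries`).
* Step E: local convergence with multiplicity `1` by the tree's
  `PeriodicConfiguration.tendsto_sum_of_eventually_near'` (`CrystallizationLocalLimit`).
-/

noncomputable section

namespace Summit.AtomisticToContinuum.Crystallization.Theorems.EnergyDerivativeOrderLimitTransfer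

open scoped BigOperators Topology
open Filter Set Metric
open Literature.MathematicalPhysics.StatisticalMechanics

variable {a h : ℝ}

/-- **An isometric image of hcp is the point set of a periodic configuration**: for an isometry
`g` of `ℝ³`, `g '' hcpStacking a h` is the point set of the translate by `g 0` of the image of
the hcp periodic configuration under the linear part of `g` (Mazur–Ulam). [folklore] -/
theorem exists_periodicConfiguration_image (ha : a ≠ 0) (hh : h ≠ 0)
    (g : EuclideanSpace ℝ (Fin 3) ≃ᵢ EuclideanSpace ℝ (Fin 3)) :
    ∃ P : PeriodicConfiguration 3, P.points = g '' hcpStacking a h := by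
  set g₀ : EuclideanSpace ℝ (Fin 3) ≃ᵢ EuclideanSpace ℝ (Fin 3) :=
    g.trans (IsometryEquiv.addRight (-(g 0))) with hg₀_def
  have hg₀ : ∀ p, g₀ p = g p - g 0 := fun p => by
    simp [hg₀_def, sub_eq_add_neg]
  have hg₀0 : g₀ 0 = 0 := by rw [hg₀, sub_self]
  set B := g₀.toRealLinearIsometryEquivOfMapZero hg₀0 with hB_def
  have hB : ∀ p, B p = g p - g 0 := fun p => by
    rw [hB_def, IsometryEquiv.coe_toRealLinearIsometryEquivOfMapZero, hg₀]
  refine ⟨((hcpPeriodicConfiguration ha hh).isometryImage B).translate (g 0), ?_⟩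
  ext z
  rw [PeriodicConfiguration.mem_points_translate, PeriodicConfiguration.mem_points_isometryImage,
    hcpPeriodicConfiguration_points]
  constructor
  · intro hz
    refine ⟨B.symm (z - g 0), hz, ?_⟩
    have h1 := hB (B.symm (z - g 0))
    rw [B.apply_symm_apply] at h1
    have : g (B.symm (z - g 0)) = z := by
      have h2 : g (B.symm (z - g 0)) - g 0 = z - g 0 := h1.symm
      exact sub_left_injective h2
    exact this
  · rintro ⟨p, hp, rfl⟩
    have : B.symm (g p - g 0) = p := by rw [← hB p, B.symm_apply_apply]
    rw [this]
    exact hp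

/-- **Shell counts of a recentred configuration as a point set**: for an injective
configuration, the number of points of `{x_l − x_{i₀}}` other than `x_j − x_{i₀}` within `ρ`
of it is the number of indices `l ≠ j` with `dist (x_l) (x_j) ≤ ρ`. [folklore] -/
theorem ncard_shell_range_eq {n : ℕ} (y : Fin n → EuclideanSpace ℝ (Fin 3))
    (hinj : Function.Injective y) (i₀ j : Fin n) (ρ : ℝ) :
    {u' ∈ Set.range (fun l : Fin n => y l - y i₀) |
        u' ≠ y j - y i₀ ∧ dist (y j - y i₀) u' ≤ ρ}.ncard =
      (Finset.univ.filter fun l => l ≠ j ∧ dist (y l) (y j) ≤ ρ).card := by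
  classical
  have hinj' : Function.Injective (fun l : Fin n => y l - y i₀) :=
    fun l l' hll' => hinj (sub_left_injective hll')
  rw [← Set.ncard_coe_finset, ← Set.ncard_image_of_injective _ hinj']
  congr 1
  ext u'
  simp only [Set.mem_setOf_eq, Set.mem_range, Set.mem_image, Finset.coe_filter, Finset.mem_univ,
    true_and]
  constructor
  · rintro ⟨⟨l, rfl⟩, hne, hd⟩
    refine ⟨l, ⟨fun hl => hne (by rw [hl]), ?_⟩, rfl⟩
    rwa [dist_sub_right, dist_comm] at hd
  · rintro ⟨l, ⟨hne, hd⟩, rfl⟩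
    refine ⟨⟨l, rfl⟩, fun hl => hne (hinj' hl), ?_⟩
    rwa [dist_sub_right, dist_comm]

/-- **Item stmt-AtomisticToContinuum-12284** (`LimitTransfer`, route EnergyDerivativeOrder): the
potential-free positional half of the route — pair statistics of hcp plus a uniform minimal
distance give Blanc–Lewin local convergence to an isometric image of hcp, given the
distance-spectrum rigidity of hcp (`SpectralRigidityHcp`) and the gapped kissing bound
(`GappedKissingBound`). See the module docstring for the proof. [folklore] -/
theorem limitTransfer_proof :
    Summit.AtomisticToContinuum.Crystallization.Theses.EnergyDerivativeOrder.LimitTransfer := by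
  unfold Summit.AtomisticToContinuum.Crystallization.Theses.EnergyDerivativeOrder.LimitTransfer
    Summit.AtomisticToContinuum.Crystallization.Theses.EnergyDerivativeOrder.SpectralRigidityHcp
    Summit.AtomisticToContinuum.Crystallization.Theses.EnergyDerivativeOrder.GappedKissingBound
  intro hC2 hGKB a h ha hh ha0 hw x hδsep hstat
  obtain ⟨δ, hδ, hsep⟩ := hδsep
  have hh0 : 0 < h := window_h_pos ha0 hw
  -- Step A: at every scale, eventually a good particle
  have hA : ∀ k : ℕ, ∀ᶠ N in atTop, ∃ i : Fin N,
      (∀ l l', dist (x N l) (x N i) ≤ 2 * a + k → dist (x N l') (x N i) ≤ 2 * a + k → l ≠ l' →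
        ∃ p ∈ hcpStacking a h, ∃ q ∈ hcpStacking a h,
          p ≠ q ∧ |dist (x N l) (x N l') - dist p q| < a / 4000 / ((k : ℝ) + 1)) ∧
      ∀ j, dist (x N j) (x N i) ≤ 2 * a + k →
        (Finset.univ.filter fun l => l ≠ j ∧ dist (x N l) (x N j) ≤ 6 / 5 * a).card = 12 := by
    intro k
    have hk0 : (0 : ℝ) ≤ k := Nat.cast_nonneg k
    refine eventually_exists_good hGKB ha hh ha0 hw x hδ hsep hstat (by linarith) (by positivity) ?_
    rw [div_le_iff₀ (by positivity)]
    nlinarith [div_nonneg ha0.le (by norm_num : (0 : ℝ) ≤ 4000)]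
  -- Step B: extraction, recentring, local limit
  obtain ⟨φ₀, hφ₀, hgood⟩ := extraction_forall_of_eventually hA
  choose i hclean hshell using hgood
  have hinj : ∀ N, Function.Injective (x N) := fun N => injective_of_sep hδ (hsep N)
  set T : ℕ → Set (EuclideanSpace ℝ (Fin 3)) :=
    fun k => Set.range fun j : Fin (φ₀ k) => x (φ₀ k) j - x (φ₀ k) (i k) with hT
  have hTsep : ∀ k, ∀ p ∈ T k, ∀ q ∈ T k, p ≠ q → δ ≤ dist p q := by
    rintro k _ ⟨j, rfl⟩ _ ⟨j', rfl⟩ hne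
    rw [dist_sub_right]
    exact hsep _ j j' fun hjj' => hne (by rw [hjj'])
  have hT0 : ∀ k, (0 : EuclideanSpace ℝ (Fin 3)) ∈ T k := fun k => ⟨i k, sub_self _⟩
  have hTnorm : ∀ k (j : Fin (φ₀ k)), ‖x (φ₀ k) j - x (φ₀ k) (i k)‖ = dist (x (φ₀ k) j) (x (φ₀ k) (i k)) :=
    fun k j => (dist_eq_norm _ _).symm
  obtain ⟨ψ, Y, hψ, hYsep, hlim⟩ := exists_subseq_forall_eventually_ballMatch hδ T hTsep
  -- scales along `ψ`: eventually the good radius exceeds `L` and the tolerance is below `γ`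
  have hscale : ∀ L γ : ℝ, 0 < γ → ∀ᶠ k in atTop,
      L ≤ 2 * a + (ψ k : ℕ) ∧ a / 4000 / ((ψ k : ℕ) + 1 : ℝ) < γ := by
    intro L γ hγ
    have hψ' : Tendsto (fun k => ((ψ k : ℕ) : ℝ)) atTop atTop :=
      tendsto_natCast_atTop_atTop.comp hψ.tendsto_atTop
    filter_upwards [hψ'.eventually_ge_atTop (max L (a / 4000 / γ))] with k hk
    have hk1 : L ≤ (ψ k : ℝ) := (le_max_left _ _).trans hk
    have hk2 : a / 4000 / γ ≤ (ψ k : ℝ) := (le_max_right _ _).trans hk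
    refine ⟨by linarith, ?_⟩
    rw [div_lt_iff₀ (by positivity)]
    rw [div_le_iff₀ hγ] at hk2
    nlinarith
  -- Step C: properties of the limit `Y`
  have hY0 : (0 : EuclideanSpace ℝ (Fin 3)) ∈ Y :=
    zero_mem_of_ballMatch hδ hYsep (fun k => hT0 (ψ k)) hlim
  -- (C1) pair distances
  have hpairT : ∀ L γ : ℝ, 0 < γ → ∀ᶠ k in atTop, ∀ u ∈ T (ψ k), ∀ u' ∈ T (ψ k), ‖u‖ ≤ L →
      ‖u'‖ ≤ L → u ≠ u' →
      ∃ t ∈ {t : ℝ | ∃ p ∈ hcpStacking a h, ∃ q ∈ hcpStacking a h, p ≠ q ∧ t = dist p q},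
        |dist u u' - t| < γ := by
    intro L γ hγ
    filter_upwards [hscale L γ hγ] with k hk
    rintro _ ⟨j, rfl⟩ _ ⟨j', rfl⟩ hu hu' hne
    rw [hTnorm] at hu hu'
    have hjj' : j ≠ j' := fun hjj' => hne (by rw [hjj'])
    obtain ⟨p, hp, q, hq, hpq, hd⟩ :=
      hclean (ψ k) j j' (hu.trans hk.1) (hu'.trans hk.1) hjj'
    refine ⟨dist p q, ⟨p, hp, q, hq, hpq, rfl⟩, ?_⟩
    rw [dist_sub_right]
    exact hd.trans hk.2
  have hYdist : ∀ y ∈ Y, ∀ y' ∈ Y, y ≠ y' →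
      ∃ p ∈ hcpStacking a h, ∃ q ∈ hcpStacking a h, dist y y' = dist p q := by
    intro y hy y' hy' hne
    obtain ⟨p, hp, q, hq, -, ht⟩ := dist_mem_of_ballMatch hδ hYsep hlim
      (fun M => finite_hcpDist_inter_Icc ha0 hh0 M) hpairT hy hy' hne
    exact ⟨p, hp, q, hq, ht⟩
  -- (C2) twelve neighbours
  have hshellT : ∀ L : ℝ, ∀ᶠ k in atTop, ∀ u ∈ T (ψ k), ‖u‖ ≤ L →
      {u' ∈ T (ψ k) | u' ≠ u ∧ dist u u' ≤ 6 / 5 * a}.ncard = 12 := by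
    intro L
    filter_upwards [hscale L 1 one_pos] with k hk
    rintro _ ⟨j, rfl⟩ hu
    rw [hTnorm] at hu
    rw [show T (ψ k) = Set.range fun l : Fin (φ₀ (ψ k)) => x (φ₀ (ψ k)) l - x (φ₀ (ψ k)) (i (ψ k))
      from rfl, ncard_shell_range_eq (x (φ₀ (ψ k))) (hinj _) (i (ψ k)) j (6 / 5 * a)]
    exact hshell (ψ k) j (hu.trans hk.1)
  have hgapT : ∀ L : ℝ, ∀ᶠ k in atTop, ∀ u ∈ T (ψ k), ∀ u' ∈ T (ψ k), ‖u‖ ≤ L → ‖u'‖ ≤ L →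
      6 / 5 * a - a / 10 < dist u u' → dist u u' < 6 / 5 * a + a / 10 → False := by
    intro L
    filter_upwards [hpairT L (a / 100) (by positivity)] with k hk u hu u' hu' huL hu'L h1 h2
    have hne : u ≠ u' := by
      rintro rfl
      rw [dist_self] at h1
      linarith
    obtain ⟨t, ⟨p, hp, q, hq, hpq, rfl⟩, ht⟩ := hk u hu u' hu' huL hu'L hne
    rw [abs_lt] at ht
    rcases hcp_dist_cases ha0 hw hp hq hpq with ⟨h3, h4⟩ | h5
    · linarith
    · linarith
  have hY12 : ∀ y ∈ Y, {y' ∈ Y | y' ≠ y ∧ dist y y' ≤ 6 / 5 * a}.ncard = 12 := fun y hy =>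
    ncard_shell_of_ballMatch hδ (by positivity : (0 : ℝ) < a / 10) (fun k => hTsep (ψ k)) hYsep
      hlim hshellT hgapT hy
  -- spectral rigidity: the limit is an isometric image of hcp
  obtain ⟨g, hYg⟩ := hC2 a h ha0 hw Y ⟨0, hY0⟩ hYdist hY12
  -- Step D: the periodic configuration
  obtain ⟨P, hP⟩ := exists_periodicConfiguration_image ha hh g
  -- Step E: local convergence
  have hsep' : ∀ l (j j' : Fin (φ₀ (ψ l))), j ≠ j' →
      δ ≤ dist (x (φ₀ (ψ l)) j + -x (φ₀ (ψ l)) (i (ψ l))) (x (φ₀ (ψ l)) j' + -x (φ₀ (ψ l)) (i (ψ l))) := by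
    intro l j j' hjj'
    rw [dist_add_right]
    exact hsep _ j j' hjj'
  have hmatch : ∀ R ε : ℝ, 0 < ε → ∀ᶠ l in atTop,
      (∀ s ∈ P.points, ‖s‖ ≤ R → ∃ j, dist (x (φ₀ (ψ l)) j + -x (φ₀ (ψ l)) (i (ψ l))) s ≤ ε) ∧
      (∀ j, ‖x (φ₀ (ψ l)) j + -x (φ₀ (ψ l)) (i (ψ l))‖ ≤ R →
        ∃ s ∈ P.points, dist (x (φ₀ (ψ l)) j + -x (φ₀ (ψ l)) (i (ψ l))) s ≤ ε) := by
    intro R ε hε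
    filter_upwards [hlim R ε hε] with l hl
    rw [hP, ← hYg]
    constructor
    · intro s hs hsR
      obtain ⟨u, ⟨j, rfl⟩, hus⟩ := hl.1 s hs (by rwa [dist_zero_right])
      exact ⟨j, by rw [← sub_eq_add_neg]; exact hus⟩
    · intro j hj
      rw [← sub_eq_add_neg] at hj ⊢
      obtain ⟨s, hs, hjs⟩ := hl.2 (x (φ₀ (ψ l)) j - x (φ₀ (ψ l)) (i (ψ l))) ⟨j, rfl⟩
        (by rwa [dist_zero_right])
      exact ⟨s, hs, hjs⟩
  refine ⟨φ₀ ∘ ψ, fun l => -x (φ₀ (ψ l)) (i (ψ l)), P, fun _ => 1, hφ₀.comp hψ,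
    fun _ _ => le_rfl, fun _ _ _ => rfl, fun f hfc hf => ?_⟩
  exact P.tendsto_sum_of_eventually_near'
    (fun l j => x (φ₀ (ψ l)) j + -x (φ₀ (ψ l)) (i (ψ l))) hδ hsep' hmatch hfc hf

end Summit.AtomisticToContinuum.Crystallization.Theorems.EnergyDerivativeOrderLimitTransfer

end
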